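import Literature.IUT.HodgeArakelov.IotaInvariantThetaInftyModel
import Literature.IUT.HodgeArakelov.EtaleThetaDataOfSettingCofinal
import Literature.IUT.HodgeArakelov.CohomologyLimitDivisible
import Literature.IUT.HodgeArakelov.CocycleDivisibleLevel
import Literature.AnabelianGeometry.EtaleTheta.ThetaCyclotomes
import Literature.AnabelianGeometry.EtaleTheta.Discharge.Sec2DeltaThetaTorsionFree

/-!
# [IUTchII] Prop 2.2 (ii) «respectively» clause AT THE MODEL: the binder `hdiv` (divisibility of the
# classes of `θ(Π_v)` in `lim_J`) REDUCED to the finiteness of the `Π^tp_X̲̲`-orbit of `η̲̈^Θ` modulo `N`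

S. Mochizuki, *Inter-universal Teichmüller theory II*, kurims manuscript (Dec. 2020), §2 Prop. 2.2 (ii) p. 66
l. 56–61, §1 Prop. 1.4 p. 27 ("`∞θ(Π) ⊆ lim_J H¹(Π_Ÿ(Π)|_J, (l·Δ_Θ)(Π))`", `J` the finite-index open subgroups of
`Π`) [claim: Mochizuki2012, status: disputed]. abc-iut cell, layer L6, node IUTchII:Prop2.2(ii), sub-DAG row
Prop-22.ii.r13a (abc-iut-w5-d187). `IotaInvariantThetaInftyModel.lean` (p414969) proved the clause at the model
`D := etaleThetaDataOfSetting'` modulo (hfix) and (hdiv) "`∀ t ∈ θ(Π_v), ∀ N > 0, ∃ x ∈ lim, N•x = toLim ⊤ t`".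
THIS FILE proves (hdiv) from:
* the L2 cyclotome identifications `mods M : D.CyclotomeMod l M` ("`μ_M ≅ (l·Δ_Θ) ⊗ ℤ/Mℤ`", [EtTh] p. 46;
  abc-iut-L2-t8; they supply the open finite-index mod-`M` cyclotomic-character kernels `chiKer`, on which
  `Π^tp_X̲̲` acts trivially on `l·Δ_Θ` modulo `M`-th powers, and the openness / finite index of the `M`-th powers);
* the origin guard `D.IsEtThOrigin` (F-2498; `Δ_Θ` is torsion-free, abc-iut-L2-t8 `deltaTheta_torsionfree`);
* the STRUCTURAL topological input "`Δ_Θ` is compact and `(Π^tp_X)^Θ` is Hausdorff" ([EtTh] p. 12: "a natural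
  exact sequence of abelian PROFINITE groups `1 → Δ_Θ → (Δ^tp_Y)^Θ → …`"; the interface `ThetaSetting` leaves
  the topology of `(Π^tp_X)^Θ` unconstrained, so some such input is necessary for `N`-th roots of continuous
  cocycles to be continuous);
* and ONE remaining input `hfin`: for every `N`, the `Π^tp_X̲̲`-conjugates of the root cocycle `η̲̈^Θ` have
  FINITELY MANY VALUES MODULO `N`-th powers on `Π^tp_Ÿ̲̲ ∩ chiKer(lN)` — the content of [EtTh] Prop. 1.5 (iii)
  (the `Z`-orbit of `η̈^Θ` is `η̈^Θ − 2a·log(Ü) − a²·log(q̈) + log(O^×_K̈)`) together with the finiteness of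
  `O^×_K̈/(O^×_K̈)^{lN}` (`UnitsModPowFinite.lean`); it is discharged in the companion file.
Mechanism: torsion classes (`DivisibleLevel.forall_isPow_of_pow_eq_one`) and roots of cocycles
(`DivisibleLevel.exists_class_pow_eq`) from `CohomologyLimitDivisible.lean`; the NORMAL divisibility level
of the orbit (`DivisibleLevel.level`, `CocycleDivisibleLevel.lean`) made an index of the system by COFINALITY
(`exists_finiteIndex_open_inf_eq`, `EtaleThetaDataOfSettingCofinal.lean`).

Main results: `toLim_nsmul_of_torsion` (torsion classes of `H¹(Π^tp_Ÿ̲̲, l·Δ_Θ)` are divisible in the limit),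
`toLim_nsmul_of_mem_orbitOne` (so is the orbit of `η̲̈^Θ`, given `hfin`), `hdiv_etaleThetaDataOfSetting'_of_finite`
((hdiv) given `hfin`), `inftyClause_etaleThetaDataOfSetting'_of_finite` (the clause mod hfix + `hfin`).
Auxiliary abbreviations only (`chiKer`, `rootLiftCocycle`); nothing of [IUTchII]/[EtTh] asserted; no side taken
on [IUTchIII] Cor. 3.12.
-/

namespace Literature.IUT.HodgeArakelov

open Literature.AnabelianGeometry.EtaleTheta Literature.AnabelianGeometry.SemiGraphs
open CohomologySystemOfContH1 EtaleThetaDataOfSetting DivisibleLevel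

noncomputable section

namespace EtaleThetaDataOfSetting

variable {p : ℕ} [Fact p.Prime] {D : Literature.AnabelianGeometry.EtaleTheta.ThetaSetting p}
  {E : D.EtaleThetaData} {l : ℕ} (C : E.DoubleUnderline l)

open scoped IsMulCommutative

/-! ### The mod-`M` cyclotomic-character kernels in `Π^tp_X̲̲` -/

/-- `Ker(Π^tp_X̲̲ → G_{ℚ_p} → Aut(μ_M))`, the mod-`M` cyclotomic-character kernel ([EtTh] Def. 2.10 p. 44,
"`Π_{μ_N,K} := Δ_{μ_N} ⋊ G_K`"). [cite: MochizukiEtTh2009, Def 2.10 p.44] -/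
abbrev chiKer (M : ℕ+) : Subgroup (Pi C) :=
  ((galMuN p M).comp (D.aug.toMonoidHom.comp C.Huu.subtype)).ker

/-- The cyclotomic-character kernel is open (given the identification `μ_M ≅ (l·Δ_Θ) ⊗ ℤ/Mℤ`).
[cite: MochizukiEtTh2009, Def 2.10 p.44] -/
theorem isOpen_chiKer {M : ℕ+} (μ : D.CyclotomeMod l M) : IsOpen (chiKer C M : Set (Pi C)) := by
  have h : chiKer C M = (((galMuN p M).comp D.aug.toMonoidHom).ker).comap C.Huu.subtype := by
    rw [MonoidHom.comap_ker]; rfl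
  rw [h]
  exact μ.isOpen_ker_chi.preimage continuous_subtype_val

/-- The cyclotomic-character kernel has finite index (`Aut(μ_M)` is finite). [cite: MochizukiEtTh2009, Def 2.10 p.44] -/
theorem finiteIndex_chiKer (M : ℕ+) : (chiKer C M).FiniteIndex := by
  haveI : Finite (MulAut (MuN p M)) :=
    Finite.of_injective (fun e : MulAut (MuN p M) => (e : MuN p M → MuN p M))
      (fun a b h => MulEquiv.ext (congrFun h))
  refine ⟨?_⟩
  rw [Subgroup.index_ker]
  exact Nat.card_pos.ne'

/-- On `chiKer M`, `Π^tp_X̲̲` acts trivially on `l·Δ_Θ` modulo `M`-th powers (equivariance of `μ_M ≅ (l·Δ_Θ)⊗ℤ/M`).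
[cite: MochizukiEtTh2009, Def 2.13 p.46] -/
theorem conj_mul_inv_mem_range_pow {M : ℕ+} (μ : D.CyclotomeMod l M) {g : Pi C} (hg : g ∈ chiKer C M)
    (b : D.lDeltaTheta l) :
    MulAut.conjNormal (phi C g) b * b⁻¹ ∈ (powMonoidHom (M : ℕ) : D.lDeltaTheta l →* D.lDeltaTheta l).range := by
  have hg' : galMuN p M (D.aug.toMonoidHom (g : D.PiTemp)) = 1 := hg
  have hconj : MulAut.conjNormal (phi C g) b =
      ⟨D.toTheta (g : D.PiTemp) * b * (D.toTheta (g : D.PiTemp))⁻¹, (D.lDeltaTheta_normal l).conj_mem _ b.2 _⟩ :=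
    Subtype.ext (by rw [MulAut.conjNormal_apply]; rfl)
  have hred : μ.red (MulAut.conjNormal (phi C g) b * b⁻¹) = 1 := by
    rw [map_mul, map_inv, hconj, μ.red_conj, hg', MulAut.one_apply, mul_inv_cancel]
  obtain ⟨y, hy⟩ := (μ.red_ker _).mp hred
  exact ⟨y, hy.symm⟩

/-- The `M`-th powers in `l·Δ_Θ` form the kernel of `red : (l·Δ_Θ) ↠ μ_M`. [cite: MochizukiEtTh2009, Def 2.13 p.46] -/
theorem range_pow_eq_ker_red {M : ℕ+} (μ : D.CyclotomeMod l M) :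
    (powMonoidHom (M : ℕ) : D.lDeltaTheta l →* D.lDeltaTheta l).range = μ.red.ker := by
  ext x
  rw [MonoidHom.mem_range, MonoidHom.mem_ker, μ.red_ker]
  exact ⟨fun ⟨y, hy⟩ => ⟨y, hy.symm⟩, fun ⟨y, hy⟩ => ⟨y, hy.symm⟩⟩

/-- The `M`-th powers in `l·Δ_Θ` are OPEN. [cite: MochizukiEtTh2009, Def 2.13 p.46] -/
theorem isOpen_range_pow {M : ℕ+} (μ : D.CyclotomeMod l M) :
    IsOpen ((powMonoidHom (M : ℕ) : D.lDeltaTheta l →* D.lDeltaTheta l).range : Set (D.lDeltaTheta l)) := by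
  rw [range_pow_eq_ker_red μ]
  exact (isOpen_discrete ({1} : Set (MuN p M))).preimage μ.continuous_red

/-- The `M`-th powers in `l·Δ_Θ` have FINITE INDEX (`μ_M` is finite). [cite: MochizukiEtTh2009, Def 2.13 p.46] -/
theorem finiteIndex_range_pow {M : ℕ+} (μ : D.CyclotomeMod l M) :
    ((powMonoidHom (M : ℕ) : D.lDeltaTheta l →* D.lDeltaTheta l).range).FiniteIndex := by
  rw [range_pow_eq_ker_red μ]
  refine ⟨?_⟩
  rw [Subgroup.index_ker]
  exact Nat.card_pos.ne'

/-- `N`-th powers contain `(lN)`-th powers … in the form used below: an `(l·N)`-th power is an `N`-th power.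
[cite: MochizukiEtTh2009, Def 2.13 p.46] -/
theorem range_pow_mul_le (l' N : ℕ) :
    (powMonoidHom (l' * N) : D.lDeltaTheta l →* D.lDeltaTheta l).range ≤
      (powMonoidHom N : D.lDeltaTheta l →* D.lDeltaTheta l).range := by
  rintro _ ⟨y, rfl⟩
  exact ⟨y ^ l', by simp [pow_mul]⟩

/-! ### Torsion-freeness and continuous roots in `l·Δ_Θ` -/

/-- `l·Δ_Θ` has no torsion (origin guard: `Δ_Θ` is torsion-free, abc-iut-L2-t8). [cite: MochizukiEtTh2009, §1 p.12] -/
theorem lDeltaTheta_torsionfree (hO : D.IsEtThOrigin) {n : ℕ} (hn : n ≠ 0) (a : D.lDeltaTheta l)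
    (ha : a ^ n = 1) : a = 1 := by
  apply Subtype.ext
  exact D.deltaTheta_torsionfree hO (D.lDeltaTheta_le l a.2) hn (by rw [← Subgroup.coe_pow, ha]; rfl)

/-- `l·Δ_Θ` is compact when `Δ_Θ` is (it is the continuous image `Δ_Θ^l`). [cite: MochizukiEtTh2009, §1 p.12] -/
theorem compactSpace_lDeltaTheta (hΔ : IsCompact (D.DeltaTheta : Set D.GtpTheta)) :
    CompactSpace (D.lDeltaTheta l) := by
  apply isCompact_iff_compactSpace.mp
  have h : (D.lDeltaTheta l : Set D.GtpTheta) = (fun y : D.GtpTheta => y ^ l) '' (D.DeltaTheta : Set D.GtpTheta) := by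
    ext x
    constructor
    · rintro ⟨y, hy, rfl⟩
      exact ⟨y, hy, rfl⟩
    · rintro ⟨y, hy, rfl⟩
      exact ⟨y, hy, rfl⟩
  rw [h]
  exact hΔ.image (continuous_id.pow l)

/-- Continuous `N`-th roots on the `N`-th powers of `l·Δ_Θ` (compact Hausdorff, torsion-free).
[cite: MochizukiEtTh2009, §1 p.12] -/
theorem exists_root_lDeltaTheta (hO : D.IsEtThOrigin) (hΔ : IsCompact (D.DeltaTheta : Set D.GtpTheta))
    [T2Space D.GtpTheta] {N : ℕ} (hN : N ≠ 0) :
    ∃ r : {a : D.lDeltaTheta l // ∃ b : D.lDeltaTheta l, b ^ N = a} → D.lDeltaTheta l,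
      Continuous r ∧ ∀ a, (r a) ^ N = a.1 := by
  haveI := compactSpace_lDeltaTheta (l := l) hΔ
  refine exists_continuous_root N fun a b hab => ?_
  exact eq_of_pow_eq (lDeltaTheta_torsionfree hO hN) hab

/-! ### Torsion classes of `H¹(Π^tp_Ÿ̲̲, l·Δ_Θ)` are divisible in the limit -/

/-- **Torsion classes are divisible in `lim_J`**: if `l • τ = 0` in `H¹(Π_Ÿ(Π), (l·Δ_Θ)(Π)) = H1 ⊤` then for every
`N ≥ 1` there is `x ∈ lim_J` with `N • x = toLim ⊤ τ` — restrict to `J = chiKer(lN)`, where the values of a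
cocycle of `τ` are `N`-th powers, and extract a continuous `N`-th root. [claim: Mochizuki2012, status: disputed]
(IUTchII §1 Prop 1.4, kurims p.27) -/
theorem toLim_nsmul_of_torsion (hO : D.IsEtThOrigin) (hΔ : IsCompact (D.DeltaTheta : Set D.GtpTheta))
    [T2Space D.GtpTheta] (mods : ∀ M : ℕ+, D.CyclotomeMod l M) (τ : (coh C).H1 ⊤) (hτ : l • τ = 0)
    {N : ℕ} (hN : 0 < N) : ∃ x : (coh C).lim, N • x = (coh C).toLim ⊤ τ := by
  have hl0 : l ≠ 0 := C.l_ne_zero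
  let lN : ℕ+ := ⟨l * N, Nat.mul_pos (Nat.pos_of_ne_zero hl0) hN⟩
  -- the class at `⊤` and a cocycle for it
  set z : ContH1 (phi C) (D.lDeltaTheta l) (PiYdd C ⊓ ⊤) := Additive.toMul (h1Top C τ) with hz
  have hzl : z ^ l = 1 := by
    rw [hz, ← toMul_nsmul, ← map_nsmul, hτ, map_zero, toMul_zero]
  obtain ⟨f, hf⟩ := QuotientGroup.mk_surjective z
  -- restrict to `J := chiKer (lN)`
  let J : Subgroup (Pi C) := chiKer C lN
  have hJo : IsOpen (J : Set (Pi C)) := isOpen_chiKer C (mods lN)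
  obtain ⟨r, hr, hrN⟩ := exists_root_lDeltaTheta (l := l) hO hΔ hN.ne'
  have hval : ∀ g : ↥(PiYdd C ⊓ J), ∃ b : D.lDeltaTheta l,
      b ^ N = (ContH1.resCocycle (phi C) (D.lDeltaTheta l) (inf_le_inf_left (PiYdd C) (le_top : J ≤ ⊤)) f).1 g := by
    refine forall_isPow_of_pow_eq_one f (l := l) ?_ (lDeltaTheta_torsionfree hO hl0) _ ?_
    · rw [hf]; exact hzl
    · intro g hg b
      obtain ⟨e, he⟩ := conj_mul_inv_mem_range_pow C (mods lN) (Subgroup.mem_inf.mp hg).2 b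
      exact ⟨e, he⟩
  obtain ⟨y, hy⟩ := exists_class_pow_eq r hr hrN (lDeltaTheta_torsionfree hO hN.ne') _ hval
  have hτ' : τ = (h1Top C).symm (Additive.ofMul z) := by
    rw [hz, ofMul_toMul, AddEquiv.symm_apply_apply]
  rw [hτ']
  exact toLim_top_symm_eq_nsmul_of_res_eq_pow (phi C) (D.lDeltaTheta l) (PiYdd C) z J
    (finiteIndex_chiKer C lN) hJo N y (by rw [hy, ← hf]; rfl)

/-! ### The orbit of the root class -/

/-- The chosen `l·Δ_Θ`-valued root cocycle `η̲̈^Θ|_{Π^tp_Ÿ̲̲}` as a member of `contCocycles` on `Π_Ÿ(Π) ∩ ⊤`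
(`rootLiftClass C` is its class). [cite: MochizukiEtTh2009, Def 2.7 p.41] -/
abbrev rootLiftCocycle : contCocycles (phi C) (D.lDeltaTheta l) (PiYdd C ⊓ ⊤) :=
  ⟨liftCocycle C ⊤ (rootLift C).1 (rootLift_val C), liftCocycle_mem C ⊤ (rootLift C).1 (rootLift C).2 (rootLift_val C)⟩

/-- `rootLiftClass C` is the class of `rootLiftCocycle C`. [cite: MochizukiEtTh2009, Def 2.7 p.41] -/
theorem rootLiftClass_eq : rootLiftClass C = QuotientGroup.mk (rootLiftCocycle C) := rfl

/-- **The orbit of `η̲̈^Θ` is divisible in `lim_J` — given finitely many orbit members mod `N`.** For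
`o ∈ orbitOne` (a `Π^tp_X̲̲`-conjugate of the root class) and `N ≥ 1`: if the conjugate cocycles `σ·η̲̈^Θ` have
finitely many values modulo `N`-th powers on `Π^tp_Ÿ̲̲ ∩ chiKer(lN)` (`hfin`), then `N • x = toLim ⊤ o` for some
`x` — the NORMAL divisibility level of the orbit is `Π^tp_Ÿ̲̲ ∩ J` for a finite-index open `J` (cofinality), on
which `σ·η̲̈^Θ` is an `N`-th power. [claim: Mochizuki2012, status: disputed] (IUTchII §1 Prop 1.4, kurims p.27) -/
theorem toLim_nsmul_of_mem_orbitOne (hC : D.Compat) (hS : D.Sec2Hyps) (hO : D.IsEtThOrigin)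
    (hΔ : IsCompact (D.DeltaTheta : Set D.GtpTheta)) [T2Space D.GtpTheta] (mods : ∀ M : ℕ+, D.CyclotomeMod l M)
    {N : ℕ} (hN : 0 < N)
    (hfin : ∃ T : Finset (↥(PiYdd C ⊓ ⊤) → D.lDeltaTheta l), ∀ σ : Pi C, ∃ t ∈ T, ∀ g : ↥(PiYdd C ⊓ ⊤),
      haveI := piYdd_normal C hC
      (g : Pi C) ∈ chiKer C ⟨l * N, Nat.mul_pos (Nat.pos_of_ne_zero C.l_ne_zero) hN⟩ →
        (t g)⁻¹ * (ContH1.conjCocycle (phi C) (D.lDeltaTheta l) σ (rootLiftCocycle C)).1 g ∈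
          (powMonoidHom N : D.lDeltaTheta l →* D.lDeltaTheta l).range)
    {o : (coh C).H1 ⊤} (ho : o ∈ orbitOne C hC) : ∃ x : (coh C).lim, N • x = (coh C).toLim ⊤ o := by
  haveI := piYdd_normal C hC
  have hl0 : l ≠ 0 := C.l_ne_zero
  let lN : ℕ+ := ⟨l * N, Nat.mul_pos (Nat.pos_of_ne_zero hl0) hN⟩
  obtain ⟨σ, rfl⟩ := ho
  -- the data of the generic level construction
  let H : Subgroup (Pi C) := PiYdd C ⊓ ⊤
  let K : Subgroup (Pi C) := chiKer C lN
  haveI hKfi : K.FiniteIndex := finiteIndex_chiKer C lN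
  let AM : Subgroup (D.lDeltaTheta l) := (powMonoidHom N : D.lDeltaTheta l →* D.lDeltaTheta l).range
  have hK : ∀ g ∈ K, ∀ b : D.lDeltaTheta l, MulAut.conjNormal (phi C g) b * b⁻¹ ∈ AM := fun g hg b =>
    range_pow_mul_le l N (conj_mul_inv_mem_range_pow C (mods lN) hg b)
  let 𝒞 : Set (contCocycles (phi C) (D.lDeltaTheta l) H) :=
    Set.range fun σ : Pi C => ContH1.conjCocycle (phi C) (D.lDeltaTheta l) σ (rootLiftCocycle C)
  have hstab : ∀ τ : Pi C, ∀ c ∈ 𝒞, ContH1.conjCocycle (phi C) (D.lDeltaTheta l) τ c ∈ 𝒞 := by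
    rintro τ _ ⟨σ, rfl⟩
    exact ⟨τ * σ, ContH1.conjCocycle_mul τ σ _⟩
  have hfin' : ∃ T : Finset (H → D.lDeltaTheta l), ∀ c ∈ 𝒞, ∃ t ∈ T, ∀ g : H, (g : Pi C) ∈ K →
      (t g)⁻¹ * c.1 g ∈ AM := by
    obtain ⟨T, hT⟩ := hfin
    refine ⟨T, ?_⟩
    rintro _ ⟨σ, rfl⟩
    exact hT σ
  -- the normal divisibility level and a cofinal index `J`
  let N₀ : Subgroup (Pi C) := level 𝒞 hK
  haveI hN₀n : N₀.Normal := level_normal hstab fun x a ⟨b, hb⟩ => ⟨MulAut.conjNormal x b, by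
    rw [← hb]; exact (map_pow _ b N).symm⟩
  have hHo : IsOpen (H : Set (Pi C)) := by
    change IsOpen ((PiYdd C ⊓ ⊤ : Subgroup (Pi C)) : Set (Pi C))
    rw [inf_top_eq]; exact isOpen_PiYdd C hS
  have hN₀o : IsOpen (N₀ : Set (Pi C)) :=
    isOpen_level hfin' hHo (isOpen_chiKer C (mods lN)) (isOpen_range_pow (mods ⟨N, hN⟩))
  have hN₀fi : (N₀.subgroupOf (PiYdd C)).FiniteIndex := by
    have h := finiteIndex_level (hK := hK) hfin' (finiteIndex_range_pow (mods ⟨N, hN⟩))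
    have h' : N₀.relIndex (PiYdd C ⊓ ⊤) ≠ 0 := h.1
    rw [inf_top_eq] at h'
    exact ⟨h'⟩
  have hN₀le : N₀ ≤ PiYdd C := (level_le_left 𝒞).trans inf_le_left
  obtain ⟨J, hJ, hJo, hJN₀⟩ := exists_finiteIndex_open_inf_eq C hS N₀ hN₀le hN₀o hN₀fi
  -- on `Π_Ÿ ∩ J = N₀` the conjugate cocycle is valued in `N`-th powers
  set c : contCocycles (phi C) (D.lDeltaTheta l) H :=
    ContH1.conjCocycle (phi C) (D.lDeltaTheta l) σ (rootLiftCocycle C) with hc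
  have hcmem : c ∈ 𝒞 := ⟨σ, rfl⟩
  obtain ⟨r, hr, hrN⟩ := exists_root_lDeltaTheta (l := l) hO hΔ hN.ne'
  have hval : ∀ g : ↥(PiYdd C ⊓ J), ∃ b : D.lDeltaTheta l,
      b ^ N = (ContH1.resCocycle (phi C) (D.lDeltaTheta l) (inf_le_inf_left (PiYdd C) (le_top : J ≤ ⊤)) c).1 g := by
    intro g
    have hg : (g : Pi C) ∈ N₀ := by rw [← hJN₀]; exact g.2
    obtain ⟨b, hb⟩ := apply_mem_of_mem_level hcmem ⟨g, inf_le_inf_left (PiYdd C) (le_top : J ≤ ⊤) g.2⟩ hg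
    exact ⟨b, hb⟩
  obtain ⟨y, hy⟩ := exists_class_pow_eq r hr hrN (lDeltaTheta_torsionfree hO hN.ne') _ hval
  exact toLim_top_symm_eq_nsmul_of_res_eq_pow (phi C) (D.lDeltaTheta l) (PiYdd C) _ J hJ hJo N y
    (by rw [hy]; rfl)

/-! ### (hdiv) and the «respectively» clause, given orbit finiteness -/

/-- **(hdiv) at the model, from orbit finiteness**: every class of `θ(Π_v)` (a `μ_l`-multiple of the
reciprocal of an orbit member: `l • (t + o) = 0`) is divisible by every `N ≥ 1` in `lim_J` — the torsion part
by `toLim_nsmul_of_torsion`, the orbit part by `toLim_nsmul_of_mem_orbitOne`.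
[claim: Mochizuki2012, status: disputed] (IUTchII §2 Prop 2.2 (ii), kurims p.66) -/
theorem hdiv_etaleThetaDataOfSetting'_of_finite (hC : D.Compat) (hS : D.Sec2Hyps) (hO : D.IsEtThOrigin)
    (hΔ : IsCompact (D.DeltaTheta : Set D.GtpTheta)) [T2Space D.GtpTheta] (mods : ∀ M : ℕ+, D.CyclotomeMod l M)
    (hchar : PiYddCharacteristic C) (S : BadPlaceSetting.{0}) (eS : (Pi C) ≃ₜ* S.PiX) (hl : S.l = l)
    (hfin : ∀ (N : ℕ) (hN : 0 < N), ∃ T : Finset (↥(PiYdd C ⊓ ⊤) → D.lDeltaTheta l), ∀ σ : Pi C, ∃ t ∈ T,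
      ∀ g : ↥(PiYdd C ⊓ ⊤), haveI := piYdd_normal C hC
      (g : Pi C) ∈ chiKer C ⟨l * N, Nat.mul_pos (Nat.pos_of_ne_zero C.l_ne_zero) hN⟩ →
        (t g)⁻¹ * (ContH1.conjCocycle (phi C) (D.lDeltaTheta l) σ (rootLiftCocycle C)).1 g ∈
          (powMonoidHom N : D.lDeltaTheta l →* D.lDeltaTheta l).range) :
    ∀ t ∈ (etaleThetaDataOfSetting' C hC hS hchar S.toThetaSetting eS hl).theta, ∀ N : ℕ, 0 < N →
      ∃ x : (coh C).lim, N • x = (coh C).toLim ⊤ t := by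
  intro t ht N hN
  rw [etaleThetaDataOfSetting'_theta] at ht
  obtain ⟨o, ho, hlo⟩ := ht
  have hlo' : l • ((show (coh C).H1 ⊤ from t) + o) = 0 := hlo
  obtain ⟨x₁, hx₁⟩ := toLim_nsmul_of_torsion C hO hΔ mods _ hlo' hN
  obtain ⟨x₂, hx₂⟩ := toLim_nsmul_of_mem_orbitOne C hC hS hO hΔ mods hN (hfin N hN) ho
  refine ⟨x₁ - x₂, ?_⟩
  rw [smul_sub, hx₁, hx₂, map_add, add_sub_cancel_right]

/-- **IUTchII:Prop2.2(ii)** «respectively» clause AT THE MODEL with (hdiv) DISCHARGED down to orbit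
finiteness: `InftyClause` holds for every `IotaInvariantTheta'` datum over `etaleThetaDataOfSetting'`, given
(hfix) [cyclotomic character nontrivial on finite-index subgroups; abc-iut-w4-d041], the cyclotome
identifications `mods`, the origin guard, `Δ_Θ` compact / `(Π^tp_X)^Θ` Hausdorff, and (hfin) finitely many
orbit members mod `N`. [claim: Mochizuki2012, status: disputed] (IUTchII §2 Prop 2.2 (ii), kurims p.66) -/
theorem inftyClause_etaleThetaDataOfSetting'_of_finite (hC : D.Compat) (hS : D.Sec2Hyps) (hO : D.IsEtThOrigin)
    (hΔ : IsCompact (D.DeltaTheta : Set D.GtpTheta)) [T2Space D.GtpTheta] (mods : ∀ M : ℕ+, D.CyclotomeMod l M)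
    (hchar : PiYddCharacteristic C) (S : BadPlaceSetting.{0}) (eS : (Pi C) ≃ₜ* S.PiX) (hl : S.l = l)
    {T : TemperedCoverings S (Pi C)}
    {Dec : SubgraphDecomposition S T (etaleThetaDataOfSetting' C hC hS hchar S.toThetaSetting eS hl)}
    (Θ : IotaInvariantTheta' Dec)
    (hfix : ∀ K' : Subgroup (Pi C), K'.FiniteIndex → ∀ a : ↥(D.lDeltaTheta l),
      (∀ n : Pi C, n ∈ PiYdd C ⊓ K' → MulAut.conjNormal (phi C n) a = a) → a = 1)
    (hfin : ∀ (N : ℕ) (hN : 0 < N), ∃ T : Finset (↥(PiYdd C ⊓ ⊤) → D.lDeltaTheta l), ∀ σ : Pi C, ∃ t ∈ T,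
      ∀ g : ↥(PiYdd C ⊓ ⊤), haveI := piYdd_normal C hC
      (g : Pi C) ∈ chiKer C ⟨l * N, Nat.mul_pos (Nat.pos_of_ne_zero C.l_ne_zero) hN⟩ →
        (t g)⁻¹ * (ContH1.conjCocycle (phi C) (D.lDeltaTheta l) σ (rootLiftCocycle C)).1 g ∈
          (powMonoidHom N : D.lDeltaTheta l →* D.lDeltaTheta l).range) :
    Θ.InftyClause :=
  inftyClause_etaleThetaDataOfSetting' C hC hS hchar S eS hl Θ hfix
    (hdiv_etaleThetaDataOfSetting'_of_finite C hC hS hO hΔ mods hchar S eS hl hfin)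

end EtaleThetaDataOfSetting

end

end Literature.IUT.HodgeArakelov
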